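import Summits.CriticalPhenomena.PercolationContinuityZ3.Theorems.PercNearOneGluingNoHeavyLowerTailSahiE3AndOrBlock
import Mathlib.Tactic
import HarnessLib
import HarnessLib.Audit

/-!
# `NoHeavyLowerTail` (crux stmt-CriticalPhenomena-4575), Sahi programme P4: flagship block `x₀ ∧ (x₁ ∨ x₂)` — assembly tools, part 2

Support file (cell `prim-l12`, seat P4, generation 23; `--supports stmt-CriticalPhenomena-4575`).  No named facts, no sorries;
standard axioms; def-free.  Complements `…SahiE3AndOrBlock` with the remaining finite facts the generated level-`∅` assembly
(HOME prim-l12-p4/code/gen23/asm/genasm.py) uses in every branch: `univ_up`; the masses of the sub-singletons of `V`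
(`mass_Pi110`, `mass_Pi101`, `mass_Pi110_101` — the minimal crossing cells `Π_min`); the traced crossing-cell identity `xi_inter_V`;
and membership transfer between a set and its trace (`mem_of_trace`, `not_mem_of_trace`, `not_mem_of_trace_empty`).
`V` is the literal `{110, 101, 111}` = `{![true,true,false], ![true,false,true], ![true,true,true]}` throughout.
-/

namespace Summit.CriticalPhenomena.PercolationContinuityZ3.Theorems.SahiE3AndOrTools

open Finset
open scoped BigOperators

/-- The whole cube is up-closed (hat of the trace `V`). [this work] -/
theorem univ_up : ∀ a ∈ (Finset.univ : Finset (Fin 3 → Bool)), ∀ b : Fin 3 → Bool, a ≤ b → b ∈ (Finset.univ : Finset (Fin 3 → Bool)) :=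
  fun _ _ b _ => Finset.mem_univ b

/-- `μ({110}) = A·b·(1−c)`. [this work] -/
theorem mass_Pi110 (A b c : ℝ) (μ : (Fin 3 → Bool) → ℝ)
    (hμ : ∀ x, μ x = (if x 0 then A else 1 - A) * ((if x 1 then b else 1 - b) * (if x 2 then c else 1 - c))) :
    ∑ x ∈ ({![true, true, false]} : Finset (Fin 3 → Bool)), μ x = A * b * (1 - c) := by
  rw [Finset.sum_singleton, hμ]; simp; ring

/-- `μ({101}) = A·(1−b)·c`. [this work] -/
theorem mass_Pi101 (A b c : ℝ) (μ : (Fin 3 → Bool) → ℝ)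
    (hμ : ∀ x, μ x = (if x 0 then A else 1 - A) * ((if x 1 then b else 1 - b) * (if x 2 then c else 1 - c))) :
    ∑ x ∈ ({![true, false, true]} : Finset (Fin 3 → Bool)), μ x = A * ((1 - b) * c) := by
  rw [Finset.sum_singleton, hμ]; simp

/-- `μ({110, 101}) = A·(b + c − 2bc)`. [this work] -/
theorem mass_Pi110_101 (A b c : ℝ) (μ : (Fin 3 → Bool) → ℝ)
    (hμ : ∀ x, μ x = (if x 0 then A else 1 - A) * ((if x 1 then b else 1 - b) * (if x 2 then c else 1 - c))) :
    ∑ x ∈ ({![true, true, false], ![true, false, true]} : Finset (Fin 3 → Bool)), μ x = A * (b + c - 2 * b * c) := by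
  rw [Finset.sum_insert (by decide), Finset.sum_singleton, hμ, hμ]; simp; ring

/-- The crossing cell traced on `V`, in terms of the four traces:
`((K \ L) ∩ (L' \ K')) ∩ V = ((K∩V) \ (L∩V)) ∩ ((L'∩V) \ (K'∩V))`. [this work] -/
theorem xi_inter_V (K L L' K' : Finset (Fin 3 → Bool)) :
    ((K \ L) ∩ (L' \ K')) ∩ ({![true, true, false], ![true, false, true], ![true, true, true]} : Finset (Fin 3 → Bool))
      = ((K ∩ {![true, true, false], ![true, false, true], ![true, true, true]})
          \ (L ∩ {![true, true, false], ![true, false, true], ![true, true, true]}))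
        ∩ ((L' ∩ {![true, true, false], ![true, false, true], ![true, true, true]})
          \ (K' ∩ {![true, true, false], ![true, false, true], ![true, true, true]})) := by
  ext x; simp only [Finset.mem_inter, Finset.mem_sdiff]; tauto

/-- Membership in a set from membership in its trace. [this work] -/
theorem mem_of_trace {S T : Finset (Fin 3 → Bool)} {x : Fin 3 → Bool}
    (hT : S ∩ ({![true, true, false], ![true, false, true], ![true, true, true]} : Finset (Fin 3 → Bool)) = T) (hx : x ∈ T) :
    x ∈ S := by
  have : x ∈ S ∩ ({![true, true, false], ![true, false, true], ![true, true, true]} : Finset (Fin 3 → Bool)) := by rw [hT]; exact hx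
  exact (Finset.mem_inter.1 this).1

/-- Non-membership of a point of `V` from the trace. [this work] -/
theorem not_mem_of_trace {S T : Finset (Fin 3 → Bool)} {x : Fin 3 → Bool}
    (hT : S ∩ ({![true, true, false], ![true, false, true], ![true, true, true]} : Finset (Fin 3 → Bool)) = T)
    (hx : x ∈ ({![true, true, false], ![true, false, true], ![true, true, true]} : Finset (Fin 3 → Bool)) ∧ x ∉ T) : x ∉ S := by
  intro h
  have : x ∈ S ∩ ({![true, true, false], ![true, false, true], ![true, true, true]} : Finset (Fin 3 → Bool)) :=
    Finset.mem_inter.2 ⟨h, hx.1⟩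
  rw [hT] at this; exact hx.2 this

/-- Non-membership of a point of `V` in a set with empty trace. [this work] -/
theorem not_mem_of_trace_empty {S : Finset (Fin 3 → Bool)} {x : Fin 3 → Bool}
    (hT : S ∩ ({![true, true, false], ![true, false, true], ![true, true, true]} : Finset (Fin 3 → Bool)) = ∅)
    (hx : x ∈ ({![true, true, false], ![true, false, true], ![true, true, true]} : Finset (Fin 3 → Bool))) : x ∉ S := by
  intro h
  have : x ∈ S ∩ ({![true, true, false], ![true, false, true], ![true, true, true]} : Finset (Fin 3 → Bool)) :=
    Finset.mem_inter.2 ⟨h, hx⟩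
  rw [hT] at this; simp at this

end Summit.CriticalPhenomena.PercolationContinuityZ3.Theorems.SahiE3AndOrTools
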